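import Mathlib
import HarnessLib
import Summits.Ventures.LatticeQCDFlow.Exactness.HeatBathSweepCompact
import Summits.Ventures.LatticeQCDFlow.Exactness.DoeblinUniqueness
import Summits.Ventures.LatticeQCDFlow.Exactness.RadialPolar

/-!
# The CP(N−1) heat-bath sweep (sites and links) converges to the lattice CP(N−1) Gibbs law from every start

HONEST FRAMING: exact (Metropolis-corrected) sampling algorithms for lattice gauge theory;
figures of merit are autocorrelation/cost numbers at stated couplings and volumes; no
continuum-physics claim.

Venture `LatticeQCDFlow` (cell pub-lqcd), topic `Exactness`, FANOUT row 9 (eng-latcore, the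
engine `latflow.core`).  NEW WORK of the cell: the CP(N−1) INSTANCE of row 9's heat-bath ergodicity
theorems (`HeatBathSweepErgodic.lean`, `HeatBathSweepCompact.lean`, `DoeblinUniqueness.lean`), on the
configuration space of the engine's `cpn_2d` (sites on the unit sphere of `ℝ^{2N} ≅ ℂ^N`, links on
the unit circle) with the uniform surface measures (`RadialPolar.uniformSphere`) as reference.
Nothing is cited as a fact.  TYPED-EXACTNESS-MAP (gen-11): "the CP(N−1) heat bath AS A MARKOV CHAIN
on the lattice is not typed (no CP(N−1) action in the tree; every DRAW is typed)" — closed here for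
the standard (nearest-neighbour, auxiliary-U(1)) action.

The lattice is abstract: finite sets of sites `V` and directed links `E` with endpoints
`src, tgt : E → V` (the engine: `V = (ℤ/L)²`, `E = V × {0,1}`, `src (x,μ) = x`, `tgt (x,μ) = x + μ̂`).
A configuration assigns to each site a point of `S^{d+1} ⊂ ℝ^{d+2}` (`d + 2 = 2N`) and to each link a
point of `S¹ ⊂ ℝ²`; both kinds are ONE dependent family `CPNVar i = sphere ⊂ ℝ^{cpnDim i + 2}`
(`cpnDim = d` on sites, `0` on links), so every instance the ergodicity theorems need is generic.
The complex structure enters only through a fixed linear map `J` of `ℝ^{d+2}` (for CP(N−1):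
multiplication by `i`, realified): `Re(z̄_x λ z_y) = λ₀⟨z_x, z_y⟩ − λ₁⟨z_x, J z_y⟩`, and the
STANDARD ACTION is `S(ω) = −Σ_e c_e (λ_e,₀ ⟨z_{src e}, z_{tgt e}⟩ − λ_e,₁ ⟨z_{src e}, J z_{tgt e}⟩)`
(`c_e = 2Nβ` in the engine's normalisation `κ = 2Nβ‖F‖`; any real weights here).

* `cpnDim`, `CPNVar`, `siteVec`, `linkVec`, **`cpnAction`**; `continuous_cpnAction`;
* `cpnGibbsLaw` := row 9's `piGibbsLaw` of the uniform-sphere references with density `e^{−S}` —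
  the finite-volume lattice CP(N−1) law (standard action) in this vocabulary;
* **`cpn_heatBathSweep_uniformlyErgodic`** — every scan of the TRUE single-variable heat baths (each
  site redrawn from its conditional — the vMF law `∝ e^{κ⟨m,z⟩}` the engine samples exactly,
  `VMFSiteHeatBathGeneral.lean`; each link from its von Mises conditional, `BestFisherAngle.lean`)
  visiting every site and link converges to `cpnGibbsLaw` from EVERY initial law, setwise,
  geometrically: an explicit `ε ∈ (0,1]` with `|μ₀Kᵗ(A) − π(A)| ≤ (1 − ε)ᵗ`;
  **`cpn_heatBathSweep_comp_uniformlyErgodic`** — the same followed by any exact kernel (the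
  over-relaxation / over-heat-bath sweeps of `composite_sweep`); **`cpnGibbsLaw_unique_invariant`**.

NOT CLAIMED: the Symanzik-improved action (`symanzik-tree`: two-link terms, not of the form above);
that the engine's per-site sampler parameters `κ = c‖F‖`, `m = F/‖F‖` are read off this `S` (LAW side:
the conditional density at a site is `e^{⟨z, F⟩}` up to a factor constant in `z` — immediate from the
bilinear form of `S`, index bookkeeping only); any useful rate; floating point.
-/

namespace Summit.Ventures.LatticeQCDFlow.Exactness

open MeasureTheory ProbabilityTheory Metric
open scoped ENNReal InnerProductSpace

section CPN

variable (V E : Type*) [Fintype V] [Fintype E] [DecidableEq V] [DecidableEq E] (d : ℕ)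

/-- Fibre dimension minus two: `d` on sites (`S^{d+1} ⊂ ℝ^{d+2} = ℂ^N`, `d + 2 = 2N`), `0` on links (`S¹ ⊂ ℝ²`). -/
abbrev cpnDim : V ⊕ E → ℕ := Sum.elim (fun _ => d) (fun _ => 0)

/-- The variable at index `i`: a point of the unit sphere of `ℝ^{cpnDim i + 2}`. -/
abbrev CPNVar (i : V ⊕ E) : Type := sphere (0 : EuclideanSpace ℝ (Fin (cpnDim V E d i + 2))) 1

/-- A CP(N−1) lattice configuration: sites and links together. -/
abbrev CPNConfig : Type _ := Π i : V ⊕ E, CPNVar V E d i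

/-- The reference law: the uniform probability on each sphere / circle. -/
noncomputable def cpnRef (i : V ⊕ E) : Measure (CPNVar V E d i) :=
  uniformSphere (volume : Measure (EuclideanSpace ℝ (Fin (cpnDim V E d i + 2))))

/-- Each reference law is a probability measure. -/
instance isProbabilityMeasure_cpnRef (i : V ⊕ E) : IsProbabilityMeasure (cpnRef V E d i) := by
  unfold cpnRef; infer_instance

variable {V E d}

/-- The site vector `z_v ∈ ℝ^{d+2}`. -/
def siteVec (ω : CPNConfig V E d) (v : V) : EuclideanSpace ℝ (Fin (d + 2)) := (ω (Sum.inl v)).val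

/-- The link phase `λ_e ∈ ℝ²` (`(cos θ, sin θ)`). -/
def linkVec (ω : CPNConfig V E d) (e : E) : EuclideanSpace ℝ (Fin 2) := (ω (Sum.inr e)).val

omit [Fintype V] [Fintype E] [DecidableEq V] [DecidableEq E] in
/-- `siteVec · v` is continuous. -/
theorem continuous_siteVec (v : V) : Continuous fun ω : CPNConfig V E d => siteVec ω v := by
  unfold siteVec
  exact (continuous_apply (Sum.inl v)).subtype_val

omit [Fintype V] [Fintype E] [DecidableEq V] [DecidableEq E] in
/-- `linkVec · e` is continuous. -/
theorem continuous_linkVec (e : E) : Continuous fun ω : CPNConfig V E d => linkVec ω e := by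
  unfold linkVec
  exact (continuous_apply (Sum.inr e)).subtype_val

variable (src tgt : E → V) (J : EuclideanSpace ℝ (Fin (d + 2)) →L[ℝ] EuclideanSpace ℝ (Fin (d + 2))) (c : E → ℝ)

/-- **The standard CP(N−1) lattice action** (auxiliary-`U(1)` form, realified):
`S(ω) = −Σ_e c_e (λ_e,₀ ⟨z_{src e}, z_{tgt e}⟩ − λ_e,₁ ⟨z_{src e}, J z_{tgt e}⟩)`. -/
noncomputable def cpnAction (ω : CPNConfig V E d) : ℝ :=
  -∑ e, c e * (linkVec ω e 0 * ⟪siteVec ω (src e), siteVec ω (tgt e)⟫_ℝ -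
    linkVec ω e 1 * ⟪siteVec ω (src e), J (siteVec ω (tgt e))⟫_ℝ)

omit [Fintype V] [DecidableEq V] [DecidableEq E] in
/-- **The action is a continuous function of the configuration.** -/
theorem continuous_cpnAction : Continuous (cpnAction src tgt J c) := by
  unfold cpnAction
  refine (continuous_finsetSum _ fun e _ => continuous_const.mul ?_).neg
  have h0 : Continuous fun ω : CPNConfig V E d => linkVec ω e 0 :=
    (EuclideanSpace.proj (0 : Fin 2)).continuous.comp (continuous_linkVec e)
  have h1 : Continuous fun ω : CPNConfig V E d => linkVec ω e 1 :=
    (EuclideanSpace.proj (1 : Fin 2)).continuous.comp (continuous_linkVec e)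
  exact (h0.mul ((continuous_siteVec (src e)).inner (continuous_siteVec (tgt e)))).sub
    (h1.mul ((continuous_siteVec (src e)).inner (J.continuous.comp (continuous_siteVec (tgt e)))))

/-- **The finite-volume lattice CP(N−1) law** (standard action): density `e^{−S}` against the product
of the uniform laws, normalised. -/
noncomputable def cpnGibbsLaw : Measure (CPNConfig V E d) :=
  piGibbsLaw (cpnRef V E d) (gibbsDensity (cpnAction src tgt J c))

/-- **THE CP(N−1) HEAT-BATH SWEEP CONVERGES TO THE LATTICE CP(N−1) LAW FROM EVERY START.**  Every scan of
single-variable heat baths (sites from their vMF conditionals, links from their von Mises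
conditionals, relative to the uniform references) visiting every site and link satisfies, for an
explicit `ε ∈ (0,1]`: `|μ₀Kᵗ(A) − π(A)| ≤ (1 − ε)ᵗ` for every initial law, every `t`, every set. -/
theorem cpn_heatBathSweep_uniformlyErgodic {l : List (V ⊕ E)} (hl : ∀ i, i ∈ l) :
    ∃ ε : ℝ, 0 < ε ∧ ε ≤ 1 ∧ ∀ (μ₀ : Measure (CPNConfig V E d)) [IsProbabilityMeasure μ₀] (t : ℕ)
      (A : Set (CPNConfig V E d)),
      |((fun ν : Measure (CPNConfig V E d) => ν.bind (cycle (l.map (siteHeatBath (cpnRef V E d)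
          (gibbsDensity (cpnAction src tgt J c))))))^[t] μ₀).real A
          - (cpnGibbsLaw src tgt J c).real A| ≤ (1 - ε) ^ t :=
  heatBathSweep_uniformlyErgodic_of_continuous (μ := cpnRef V E d) (continuous_cpnAction src tgt J c) hl

/-- **… and so does the composite sweep**: the heat-bath scan followed by any Markov kernel leaving
`e^{−S} · ⊗(uniform)` invariant (the over-relaxation / over-heat-bath sweeps). -/
theorem cpn_heatBathSweep_comp_uniformlyErgodic {l : List (V ⊕ E)} (hl : ∀ i, i ∈ l)
    (η : Kernel (CPNConfig V E d) (CPNConfig V E d)) [IsMarkovKernel η]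
    (hη : Kernel.Invariant η ((Measure.pi (cpnRef V E d)).withDensity (gibbsDensity (cpnAction src tgt J c)))) :
    ∃ ε : ℝ, 0 < ε ∧ ε ≤ 1 ∧ ∀ (μ₀ : Measure (CPNConfig V E d)) [IsProbabilityMeasure μ₀] (t : ℕ)
      (A : Set (CPNConfig V E d)),
      |((fun ν : Measure (CPNConfig V E d) => ν.bind (η ∘ₖ cycle (l.map (siteHeatBath (cpnRef V E d)
          (gibbsDensity (cpnAction src tgt J c))))))^[t] μ₀).real A
          - (cpnGibbsLaw src tgt J c).real A| ≤ (1 - ε) ^ t :=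
  heatBathSweep_comp_uniformlyErgodic_of_continuous (μ := cpnRef V E d) (continuous_cpnAction src tgt J c) hl η hη

/-- **The lattice CP(N−1) law is the unique invariant probability law of the heat-bath sweep.** -/
theorem cpnGibbsLaw_unique_invariant {l : List (V ⊕ E)} (hl : ∀ i, i ∈ l)
    {π' : Measure (CPNConfig V E d)} [IsProbabilityMeasure π']
    (hπ' : Kernel.Invariant (cycle (l.map (siteHeatBath (cpnRef V E d)
      (gibbsDensity (cpnAction src tgt J c))))) π') :
    π' = cpnGibbsLaw src tgt J c := by
  have hS := continuous_cpnAction src tgt J c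
  rcases isEmpty_or_nonempty (CPNConfig V E d) with hE | hne
  · exact absurd (measure_univ (μ := π')) (by rw [Set.univ_eq_empty_iff.2 hE, measure_empty]; exact zero_ne_one)
  obtain ⟨ωa, -, hmin⟩ := isCompact_univ.exists_isMinOn Set.univ_nonempty hS.continuousOn
  obtain ⟨ωb, -, hmax⟩ := isCompact_univ.exists_isMaxOn Set.univ_nonempty hS.continuousOn
  have hωa : ∀ ω, cpnAction src tgt J c ωa ≤ cpnAction src tgt J c ω := fun ω => (isMinOn_iff.1 hmin) ω (Set.mem_univ ω)
  have hωb : ∀ ω, cpnAction src tgt J c ω ≤ cpnAction src tgt J c ωb := fun ω => (isMaxOn_iff.1 hmax) ω (Set.mem_univ ω)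
  exact heatBathSweep_invariant_unique (μ := cpnRef V E d) (measurable_gibbsDensity hS)
    (m := ENNReal.ofReal (Real.exp (-(cpnAction src tgt J c ωb))))
    (M := ENNReal.ofReal (Real.exp (-(cpnAction src tgt J c ωa))))
    (by rw [Ne, ENNReal.ofReal_eq_zero, not_le]; exact Real.exp_pos _) ENNReal.ofReal_ne_top
    (fun ω => (gibbsDensity_bounds hωa hωb ω).1) (fun ω => (gibbsDensity_bounds hωa hωb ω).2) hl hπ'

end CPN

end Summit.Ventures.LatticeQCDFlow.Exactness
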